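import Summits.Ventures.YMGap.YM4Door.DecimationFlow

/-!
# YM4Door / PathTransport — OBSERVABLES PULLED BACK ALONG PATH BLOCKINGS: covariance by oscillations, Lipschitz loads along
# parallel transporters (`pathLink`, `pathLoad`: total load `|path| · Σδ`), and the axial geometry (representatives scale the
# periodic sup-distance by `b`; a straight path of length `b` costs `≤ b − 1`)

HONEST FRAMING (cell `ym-beyond`, seat P2 «strong-coupling bridge», HUMAN RULING D-0035 / D-0037; g9 tree edition, 2026-08-25,
≤ 400-line modules for the gate; memo `HOME/ROUTE-P2.md` v0.9 §4h, spec `HOME/ROUTE-P2-LIFT-SPEC.md` v3).  LATTICE / finite-torus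
bookkeeping only: elementary metric geometry of `SU(N)` (Frobenius distance; left/right multiplication by a unitary is an
isometry) and of the discrete torus `(ℤ/L)^d`; nothing here is a continuum, spectral or Clay-sense statement; nothing here is a part
of Bałaban's theorems.  NO conjecture name, NO `sorry`, NO axiom beyond the standard three; label K = kernel bookkeeping.

THE POINT (consumed by `YM4Door/DecimationPush.lean`).  An observable of a DECIMATED field, `U ↦ F (pathLink c p U)` — the block
link `ℓ` carrying the transporter of `U` along the lattice path `(c ℓ, p ℓ)`; the tree's axial blocking
`GaugeBlockAveraging.axial b S` is the case of the straight paths of length `b` from the representatives `b·y`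
(`UnevenAxialBlocking`, `mem_pathEdges_replicate`) — inherits every hypothesis of the strong-coupling receiver's observable
class (`SU2.BlockObservablesCluster`, module `BlockTransport`): measurability, finite dependence (on the paths,
`dependsOn_comp_pathLink`), boundedness, and coordinatewise Lipschitz bounds in the Frobenius distance with the pulled-back loads
`pathLoad` (the block load `δ ℓ` charged to every fine link of the path of `ℓ`, with multiplicity; `isLipBound_comp_pathLink`) of
total mass `≤ Σ_ℓ δ ℓ · |p ℓ|` (`sum_pathLoad_le`; `= b · Σδ` for the axial paths); and block separation `k + 1` in the sup-metric
of `(ℤ/S)^4` is fine separation `≥ b·k + 1` in `(ℤ/bS)^4` along the axial paths (`sep_of_mem_pathEdges_axial`).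

* §1 `abs_covariance_le_of_osc`: `|cov[u, v]| ≤ osc u · osc v` for bounded measurable `u, v` on a probability space.
* §2 `suFrobDist_prod_map_le` (telescoping along a word: unitary multiplication is a Frobenius isometry), `cast_count_cons` /
  `sum_map_ite_eq_count_mul` / `sum_count_eq_length` (word bookkeeping, generic in the `BEq` instance), `pathLink` /
  `pathSupport` / `pathLoad`, `measurable_pathLink`, `dependsOn_comp_pathLink`, `isLipBound_comp_pathLink`, `sum_pathLoad_le`.
* §3 `natAbs_valMinAbs_corner(_sub)` (the representatives `torusBlockCorner b S` scale every periodic coordinate distance by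
  EXACTLY `b`), `sep_of_mem_pathEdges_axial`.

References: the observable class (bounded cylinder functions with coordinatewise Lipschitz loads) is the one of the tree's
Dobrushin comparison theorem `Literature/Probability/LatticeModels/DobrushinComparisonMetric.lean` (R. L. Dobrushin,
S. B. Shlosman, in: Statistical Physics and Dynamical Systems, Birkhäuser 1985, 347–370); torus geometry from the tree's
`TorusPlaquetteNeighbours.lean`, `GaugeCovariantBlockMap.lean`, `UnevenAxialBlocking.lean`.  §1–§3 of the one text whose §4–§6 are
`YM4Door/DecimationPush.lean`.
-/
noncomputable section

open MeasureTheory ProbabilityTheory Finset Function Metric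
open scoped Matrix.Norms.Frobenius
open Literature.Probability.LatticeModels Literature.Probability.LatticeModels.DobrushinMetric
open Literature.MathematicalPhysics.QuantumLattice hiding torusNorm configShift
open Literature.MathematicalPhysics.QuantumFieldTheory hiding ZdEdge
open Summit.Ventures.YMGap.RobustBall

namespace Summit.Ventures.YMGap.YM4Door

open scoped ENNReal

/-! ## §1  Covariance by oscillations (abstract probability) -/

section Osc

variable {Ω : Type*} [MeasurableSpace Ω] {μ : Measure Ω}

/-- On a probability space a function within `R` of all its values is within `R` of its mean. -/
theorem abs_sub_integral_le_of_osc [IsProbabilityMeasure μ] {u : Ω → ℝ} (hu : Measurable u)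
    (hub : ∃ M, ∀ ω, |u ω| ≤ M) {R : ℝ} (hR : ∀ ω ω', |u ω - u ω'| ≤ R) (ω : Ω) :
    |u ω - ∫ ω', u ω' ∂μ| ≤ R := by
  obtain ⟨M, hM⟩ := hub
  have h : u ω - ∫ ω', u ω' ∂μ = ∫ ω', (u ω - u ω') ∂μ := by
    rw [integral_sub (integrable_const _) (integrable_of_abs_le hu hM)]
    simp
  rw [h]
  exact abs_integral_le_of_abs_le (hR ω)

/-- **Covariance by oscillations**: `|cov[u, v]| ≤ osc u · osc v` for bounded measurable `u, v` on a probability space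
(`cov[u, v] = E[(u − Eu)(v − Ev)]`, `|u − Eu| ≤ osc u`). -/
theorem abs_covariance_le_of_osc [IsProbabilityMeasure μ] {u v : Ω → ℝ} (hu : Measurable u) (hv : Measurable v)
    (hub : ∃ M, ∀ ω, |u ω| ≤ M) (hvb : ∃ M, ∀ ω, |v ω| ≤ M) {R T : ℝ} (hR : ∀ ω ω', |u ω - u ω'| ≤ R)
    (hT : ∀ ω ω', |v ω - v ω'| ≤ T) : |cov[u, v; μ]| ≤ R * T := by
  obtain ⟨ω₀⟩ := nonempty_of_isProbabilityMeasure μ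
  have hR0 : 0 ≤ R := (abs_nonneg _).trans (hR ω₀ ω₀)
  unfold ProbabilityTheory.covariance
  exact abs_integral_le_of_abs_le fun ω => by
    rw [abs_mul]
    exact mul_le_mul (abs_sub_integral_le_of_osc hu hub hR ω) (abs_sub_integral_le_of_osc hv hvb hT ω)
      (abs_nonneg _) hR0

end Osc

/-! ## §2  Lipschitz cylinder observables pulled back along path transporters -/

section PathLipschitz

variable {N : ℕ}

/-- Left multiplication is a Frobenius isometry of `SU(N)`. -/
theorem suFrobDist_mul_left (p a c : SUN N) : suFrobDist (p * a) (p * c) = suFrobDist a c := by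
  show frobNorm ((p : Matrix (Fin N) (Fin N) ℂ) * (a : Matrix (Fin N) (Fin N) ℂ) -
      (p : Matrix (Fin N) (Fin N) ℂ) * (c : Matrix (Fin N) (Fin N) ℂ)) =
    frobNorm ((a : Matrix (Fin N) (Fin N) ℂ) - (c : Matrix (Fin N) (Fin N) ℂ))
  rw [← mul_sub, frobNorm_unitary_mul (su_mem_unitaryGroup p)]

/-- Right multiplication is a Frobenius isometry of `SU(N)`. -/
theorem suFrobDist_mul_right (a c p : SUN N) : suFrobDist (a * p) (c * p) = suFrobDist a c := by
  show frobNorm ((a : Matrix (Fin N) (Fin N) ℂ) * (p : Matrix (Fin N) (Fin N) ℂ) -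
      (c : Matrix (Fin N) (Fin N) ℂ) * (p : Matrix (Fin N) (Fin N) ℂ)) =
    frobNorm ((a : Matrix (Fin N) (Fin N) ℂ) - (c : Matrix (Fin N) (Fin N) ℂ))
  rw [← sub_mul, frobNorm_mul_unitary _ (su_mem_unitaryGroup p)]

/-- Triangle inequality for the Frobenius distance on `SU(N)`. -/
theorem suFrobDist_triangle (a c e : SUN N) : suFrobDist a e ≤ suFrobDist a c + suFrobDist c e :=
  frobNorm_sub_le _ _ _

/-- **Telescoping along a word**: the products of two fields over the same list of links are within the sum of the
link-wise Frobenius distances (left/right unitary multiplication is an isometry). -/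
theorem suFrobDist_prod_map_le {ι : Type*} (σ τ : ι → SUN N) :
    ∀ es : List ι, suFrobDist (es.map σ).prod (es.map τ).prod ≤ (es.map fun e => suFrobDist (σ e) (τ e)).sum
  | [] => by simp [suFrobDist_self]
  | e :: es => by
      simp only [List.map_cons, List.prod_cons, List.sum_cons]
      calc suFrobDist (σ e * (es.map σ).prod) (τ e * (es.map τ).prod)
          ≤ suFrobDist (σ e * (es.map σ).prod) (τ e * (es.map σ).prod) +
              suFrobDist (τ e * (es.map σ).prod) (τ e * (es.map τ).prod) := suFrobDist_triangle _ _ _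
        _ = suFrobDist (σ e) (τ e) + suFrobDist (es.map σ).prod (es.map τ).prod := by
              rw [suFrobDist_mul_right, suFrobDist_mul_left]
        _ ≤ suFrobDist (σ e) (τ e) + (es.map fun e => suFrobDist (σ e) (τ e)).sum :=
              add_le_add le_rfl (suFrobDist_prod_map_le σ τ es)

/-- One letter of `List.count`, over `ℝ` (generic in the `BEq` instance, so that it rewrites under any instance path). -/
theorem cast_count_cons {ι : Type*} [DecidableEq ι] [BEq ι] [LawfulBEq ι] (e f : ι) (es : List ι) :
    ((List.count e (f :: es) : ℕ) : ℝ) = (List.count e es : ℝ) + if f = e then 1 else 0 := by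
  rw [List.count_cons]
  by_cases h : f = e
  · rw [if_pos h, if_pos (beq_iff_eq.2 h)]
    push_cast
    ring
  · rw [if_neg h, if_neg (mt beq_iff_eq.1 h)]
    push_cast
    ring

/-- A sum over a word of a function supported at one letter is `count × value`. -/
theorem sum_map_ite_eq_count_mul {ι : Type*} [DecidableEq ι] [BEq ι] [LawfulBEq ι] (e : ι) (D : ℝ) :
    ∀ es : List ι, (es.map fun f => if f = e then D else 0).sum = (es.count e : ℝ) * D
  | [] => by simp
  | f :: es => by
      rw [List.map_cons, List.sum_cons, sum_map_ite_eq_count_mul e D es, cast_count_cons]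
      by_cases h : f = e
      · rw [if_pos h, if_pos h]
        ring
      · rw [if_neg h, if_neg h]
        ring

/-- The multiplicities of a word sum to its length. -/
theorem sum_count_eq_length {ι : Type*} [Fintype ι] [DecidableEq ι] [BEq ι] [LawfulBEq ι] :
    ∀ es : List ι, ∑ e, (es.count e : ℝ) = es.length
  | [] => by simp
  | f :: es => by
      simp only [cast_count_cons, Finset.sum_add_distrib, sum_count_eq_length es, List.length_cons]
      rw [Finset.sum_ite_eq Finset.univ f (fun _ => (1 : ℝ)), if_pos (Finset.mem_univ f)]
      push_cast
      ring

variable {d L T : ℕ}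

/-- Each path has as many links as steps. -/
theorem length_pathEdges : ∀ (c : Site d L) (is : List (Fin d)), (pathEdges c is).length = is.length
  | _, [] => rfl
  | c, i :: is => by rw [pathEdges_cons, List.length_cons, List.length_cons, length_pathEdges (c.shift i) is]

/-- A **path blocking**: the block link `ℓ` carries the transporter of the fine field along a fixed lattice path
`(c ℓ, p ℓ)` (`GaugeBlockAveraging.axial`: `c ℓ = torusBlockCorner b S ℓ.1`, `p ℓ = replicate b ℓ.2`, `axial_link_eq_pathLink`). -/
def pathLink (c : Edge d T → Site d L) (p : Edge d T → List (Fin d)) (U : GaugeConfig d L (SUN N)) :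
    GaugeConfig d T (SUN N) :=
  fun ℓ => transport U (c ℓ) (p ℓ)

/-- The fine links feeding the block links of `Δ`. -/
def pathSupport (c : Edge d T → Site d L) (p : Edge d T → List (Fin d)) (Δ : Finset (Edge d T)) : Finset (Edge d L) :=
  Δ.biUnion fun ℓ => (pathEdges (c ℓ) (p ℓ)).toFinset

/-- The pulled-back Lipschitz loads: the block load `δ ℓ` charged to every fine link of the path of `ℓ`, with multiplicity. -/
def pathLoad (c : Edge d T → Site d L) (p : Edge d T → List (Fin d)) (Δ : Finset (Edge d T)) (δ : Edge d T → ℝ)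
    (e : Edge d L) : ℝ :=
  ∑ ℓ ∈ Δ, δ ℓ * ((pathEdges (c ℓ) (p ℓ)).count e : ℝ)

/-- A path blocking is measurable. -/
theorem measurable_pathLink (c : Edge d T → Site d L) (p : Edge d T → List (Fin d)) :
    Measurable (pathLink (N := N) c p) :=
  measurable_pi_lambda _ fun ℓ => measurable_transport (c ℓ) (p ℓ)

/-- Pulling back preserves finite dependence: `F` depends on `Δ` ⇒ `F ∘ pathLink` depends on the paths of `Δ`. -/
theorem dependsOn_comp_pathLink {c : Edge d T → Site d L} {p : Edge d T → List (Fin d)}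
    {F : GaugeConfig d T (SUN N) → ℝ} {Δ : Finset (Edge d T)} (hF : DependsOn F (↑Δ : Set (Edge d T))) :
    DependsOn (fun U => F (pathLink c p U)) (↑(pathSupport c p Δ) : Set (Edge d L)) := by
  intro U V hUV
  apply hF
  intro ℓ hℓ
  show ((pathEdges (c ℓ) (p ℓ)).map U).prod = ((pathEdges (c ℓ) (p ℓ)).map V).prod
  rw [List.map_congr_left fun f hf => hUV f
    (Finset.mem_coe.2 (Finset.mem_biUnion.2 ⟨ℓ, Finset.mem_coe.1 hℓ, List.mem_toFinset.2 hf⟩))]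

/-- **Lipschitz loads pull back along paths.**  If `δ` bounds the block-link Lipschitz constants of `F` (Frobenius
distance) and `F` depends on `Δ`, then `pathLoad Δ δ` bounds the fine-link Lipschitz constants of `F ∘ pathLink`: moving one
fine link `e` moves only the block links whose paths contain `e`, each by at most (multiplicity of `e`) × (displacement of
`e`) — left/right multiplication by unitaries is a Frobenius isometry (`suFrobDist_prod_map_le`). -/
theorem isLipBound_comp_pathLink {c : Edge d T → Site d L} {p : Edge d T → List (Fin d)}
    {F : GaugeConfig d T (SUN N) → ℝ} {Δ : Finset (Edge d T)} {δ : Edge d T → ℝ}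
    (hF : DependsOn F (↑Δ : Set (Edge d T))) (hδ : IsLipBound suFrobDist F δ) :
    IsLipBound suFrobDist (fun U => F (pathLink c p U)) (pathLoad c p Δ δ) where
  nonneg e := Finset.sum_nonneg fun ℓ _ => mul_nonneg (hδ.nonneg ℓ) (Nat.cast_nonneg _)
  le e σ τ hστ := by
    have hpath : ∀ ℓ, suFrobDist (pathLink c p σ ℓ) (pathLink c p τ ℓ) ≤
        ((pathEdges (c ℓ) (p ℓ)).count e : ℝ) * suFrobDist (σ e) (τ e) := fun ℓ => by
      refine (suFrobDist_prod_map_le σ τ _).trans (le_of_eq ?_)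
      rw [← sum_map_ite_eq_count_mul e (suFrobDist (σ e) (τ e))]
      congr 1
      refine List.map_congr_left fun f _ => ?_
      by_cases h : f = e
      · rw [if_pos h, h]
      · rw [if_neg h, hστ f h, suFrobDist_self]
    calc |F (pathLink c p σ) - F (pathLink c p τ)|
        ≤ ∑ ℓ ∈ Δ, δ ℓ * suFrobDist (pathLink c p σ ℓ) (pathLink c p τ ℓ) := abs_sub_le_sum_of_dependsOn hF hδ _ _
      _ ≤ ∑ ℓ ∈ Δ, δ ℓ * (((pathEdges (c ℓ) (p ℓ)).count e : ℝ) * suFrobDist (σ e) (τ e)) :=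
          Finset.sum_le_sum fun ℓ _ => mul_le_mul_of_nonneg_left (hpath ℓ) (hδ.nonneg ℓ)
      _ = pathLoad c p Δ δ e * suFrobDist (σ e) (τ e) := by
          rw [pathLoad, Finset.sum_mul]
          exact Finset.sum_congr rfl fun ℓ _ => by ring

/-- **Total pulled-back load**: `Σ_fine pathLoad ≤ Σ_{ℓ ∈ Δ} δ ℓ · |p ℓ|` (exactly `b·Σδ` for the axial paths). -/
theorem sum_pathLoad_le [NeZero L] {c : Edge d T → Site d L} {p : Edge d T → List (Fin d)} {Δ : Finset (Edge d T)}
    {δ : Edge d T → ℝ} (hδ : ∀ ℓ, 0 ≤ δ ℓ) :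
    ∑ e ∈ pathSupport c p Δ, pathLoad c p Δ δ e ≤ ∑ ℓ ∈ Δ, δ ℓ * ((p ℓ).length : ℝ) := by
  calc ∑ e ∈ pathSupport c p Δ, pathLoad c p Δ δ e ≤ ∑ e, pathLoad c p Δ δ e :=
        Finset.sum_le_univ_sum_of_nonneg fun e => Finset.sum_nonneg fun ℓ _ => mul_nonneg (hδ ℓ) (Nat.cast_nonneg _)
    _ = ∑ ℓ ∈ Δ, δ ℓ * ∑ e, ((pathEdges (c ℓ) (p ℓ)).count e : ℝ) := by
        simp only [pathLoad, Finset.mul_sum]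
        exact Finset.sum_comm
    _ = ∑ ℓ ∈ Δ, δ ℓ * ((p ℓ).length : ℝ) := by
        refine Finset.sum_congr rfl fun ℓ _ => ?_
        rw [sum_count_eq_length, length_pathEdges]

end PathLipschitz

/-! ## §3  Axial geometry: representatives scale the periodic sup-distance by `b`, straight paths shorten it by `≤ b − 1` -/

section AxialGeometry

variable {d b S : ℕ} [NeZero b] [NeZero S]

/-- The representative coordinate `b·z ∈ ℤ/bS` is exactly `b` times as far from `0` as `z ∈ ℤ/S`. -/
theorem natAbs_valMinAbs_corner (z : ZMod S) :
    ((((b * z.val : ℕ) : ZMod (b * S))).valMinAbs).natAbs = b * (z.valMinAbs).natAbs := by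
  have hb : 0 < b := Nat.pos_of_ne_zero (NeZero.ne b)
  have hlt : b * z.val < b * S := Nat.mul_lt_mul_of_pos_left z.val_lt hb
  rw [ZMod.valMinAbs_natAbs_eq_min, ZMod.valMinAbs_natAbs_eq_min, ZMod.val_natCast_of_lt hlt, ← mul_tsub]
  rcases le_total z.val (S - z.val) with h | h
  · rw [min_eq_left h, min_eq_left (Nat.mul_le_mul_left b h)]
  · rw [min_eq_right h, min_eq_right (Nat.mul_le_mul_left b h)]

omit [NeZero b] in
/-- The representatives are subtractive: `corner (x − y) = corner x − corner y`. -/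
theorem torusBlockCorner_sub (x y : Site d S) :
    torusBlockCorner b S (x - y) = torusBlockCorner b S x - torusBlockCorner b S y :=
  eq_sub_of_add_eq (by rw [← torusBlockCorner_add, sub_add_cancel])

/-- **Representatives scale each periodic coordinate distance by `b`.** -/
theorem natAbs_valMinAbs_corner_sub (x y : Site d S) (i : Fin d) :
    (((torusBlockCorner b S x - torusBlockCorner b S y) i).valMinAbs).natAbs = b * (((x - y) i).valMinAbs).natAbs := by
  rw [← torusBlockCorner_sub]
  exact natAbs_valMinAbs_corner ((x - y) i)

/-- A multiple `t • e_μ` read in coordinate `i` is the cast of `t` (if `i = μ`) or `0`. -/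
theorem nsmul_single_apply {L : ℕ} (t : ℕ) (μ i : Fin d) :
    (t • (Pi.single μ (1 : ZMod L) : Site d L)) i = ((if i = μ then t else 0 : ℕ) : ZMod L) := by
  rw [Pi.smul_apply, Pi.single_apply]
  split_ifs
  · rw [nsmul_eq_mul, mul_one]
  · rw [smul_zero, Nat.cast_zero]

/-- The centred size of a difference of two natural casts is at most the larger of them. -/
theorem natAbs_valMinAbs_natCast_sub_le {L : ℕ} (t s : ℕ) :
    ((((t : ZMod L) - (s : ZMod L))).valMinAbs).natAbs ≤ max t s := by
  have h := natAbs_valMinAbs_intCast_le L ((t : ℤ) - (s : ℤ))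
  push_cast at h
  refine h.trans ?_
  omega

/-- **Separation along the axial paths.**  Fine links on the straight paths (length `b`, from the representatives) of two
block links at block sup-distance `≥ k + 1` are at fine sup-distance `≥ b·k + 1`: the representatives are `≥ b(k+1)` apart in
some coordinate (`natAbs_valMinAbs_corner_sub`) and each path moves that coordinate by at most `b − 1`. -/
theorem sep_of_mem_pathEdges_axial {x y : Edge d S} {k : ℕ} (hsep : k + 1 ≤ torusNorm (x.1 - y.1))
    {e e' : Edge d (b * S)} (he : e ∈ pathEdges (torusBlockCorner b S x.1) (List.replicate b x.2))
    (he' : e' ∈ pathEdges (torusBlockCorner b S y.1) (List.replicate b y.2)) :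
    b * k + 1 ≤ torusNorm (e.1 - e'.1) := by
  obtain ⟨-, t, ht, hte⟩ := mem_pathEdges_replicate he
  obtain ⟨-, s, hs, hse⟩ := mem_pathEdges_replicate he'
  have hsep' : k + 1 ≤ Finset.univ.sup (fun i => (((x.1 - y.1) i).valMinAbs).natAbs) := hsep
  obtain ⟨i, -, hi⟩ := (Finset.le_sup_iff (show (⊥ : ℕ) < k + 1 from Nat.succ_pos k)).1 hsep'
  refine le_trans ?_ (natAbs_valMinAbs_le_torusNorm (e.1 - e'.1) i)
  have hcoord : (e.1 - e'.1) i =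
      (torusBlockCorner b S x.1 - torusBlockCorner b S y.1) i +
        ((t • (Pi.single x.2 (1 : ZMod (b * S)) : Site d (b * S))) i -
          (s • (Pi.single y.2 (1 : ZMod (b * S)) : Site d (b * S))) i) := by
    rw [hte, hse]
    simp only [Pi.sub_apply, Pi.add_apply]
    ring
  have hP : b * (k + 1) ≤ (((torusBlockCorner b S x.1 - torusBlockCorner b S y.1) i).valMinAbs).natAbs := by
    rw [natAbs_valMinAbs_corner_sub]
    exact Nat.mul_le_mul_left b hi
  have hQ : ((((t • (Pi.single x.2 (1 : ZMod (b * S)) : Site d (b * S))) i -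
      (s • (Pi.single y.2 (1 : ZMod (b * S)) : Site d (b * S))) i)).valMinAbs).natAbs ≤ b - 1 := by
    rw [nsmul_single_apply, nsmul_single_apply]
    refine (natAbs_valMinAbs_natCast_sub_le _ _).trans ?_
    split_ifs <;> omega
  have htri : ∀ P Q : ZMod (b * S),
      (P.valMinAbs).natAbs ≤ ((P + Q).valMinAbs).natAbs + (Q.valMinAbs).natAbs := fun P Q => by
    have h := ZMod.natAbs_valMinAbs_add_le (P + Q) (-Q)
    rw [add_neg_cancel_right] at h
    exact h.trans ((Int.natAbs_add_le _ _).trans (by rw [ZMod.natAbs_valMinAbs_neg]))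
  have h3 := htri ((torusBlockCorner b S x.1 - torusBlockCorner b S y.1) i)
    ((t • (Pi.single x.2 (1 : ZMod (b * S)) : Site d (b * S))) i -
      (s • (Pi.single y.2 (1 : ZMod (b * S)) : Site d (b * S))) i)
  rw [hcoord]
  have hb1 : 1 ≤ b := Nat.pos_of_ne_zero (NeZero.ne b)
  rw [mul_add_one] at hP
  omega

end AxialGeometry

end Summit.Ventures.YMGap.YM4Door

end
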